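import Literature.Probability.RandomPlanarGeometry.HexSAWBrickWallStripFugacityWidthOneComplexRoot
import Mathlib.Analysis.SpecialFunctions.Trigonometric.Bounds
import Mathlib.Analysis.SpecialFunctions.Complex.LogBounds
import Literature.Probability.Independence.LindebergFellerCLT
import HarnessLib

/-!
# The complex Perron root of the two-wall cubic to second order: `s(t) = s + a(e^{it} − 1) + b(e^{it} − 1)² + O(|t|³)`

Topic `Literature/Probability/RandomPlanarGeometry` (continues `…WidthOneComplexRoot.lean`: the cubic `F(ω,t) = ω(ω − ye^{it})(ω − z) − yze^{it}`,
its simple real root `s = μ₁(y,z)²` with `D = F_ω(s,0) > 0`).  Brick B8 of DOOR-ap5-g27 item 1 (the cubic Taylor control of the dominant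
root, input of `Literature.Probability.Independence.BerryEsseenComplexTilt`):

* §1 `perronTaylorA`, `perronTaylorB` (the first two `(e^{it} − 1)`-Taylor coefficients `a = y(s² − zs + z)/D`,
  `b = −((3s − z − y)a² − y(2s − z)a)/D`, by implicit differentiation), `perronTaylor y z t = s + a(e^{it} − 1) + b(e^{it} − 1)²`, and the
  EXACT identity ★ `twoWallCubic_perronTaylor` : `F(perronTaylor(t), t) = (e^{it} − 1)³ · H(e^{it} − 1)` with an explicit cubic `H`.
* §2 `twoWallCubic_sub_eq_mul_dividedDiff` (`F(ω₁,t) − F(ω₂,t) = (ω₁ − ω₂)·Q`), `norm_dividedDiff_sub_le` (`‖Q − D‖` small near `(s,s,0)`).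
* §3 ★★ `exists_norm_root_sub_perronTaylor_le` : for every `L` there are `t₁ > 0`, `K` with: `|t| < t₁`, `F(s',t) = 0`, `‖s' − s‖ ≤ L|t|` ⇒
  `‖s' − perronTaylor(t)‖ ≤ K|t|³` (the roots of `exists_complexPerronRoot` qualify).
* §4 `norm_cexp_sub_one_sq_add_sq_le`, ★ `exists_norm_root_sub_quadratic_le` (against `s + i a t − (a/2 + b)t²`; the Taylor bound
  `‖e^{it} − 1 − it + t²/2‖ ≤ |t|³` is the tree's `Literature.Probability.Independence.norm_cexp_mul_I_sub_taylor_two_le`),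
  ★★ `exists_norm_log_root_div_sub_le` : `‖log(s'/s) − iαt + γt²‖ ≤ K|t|³` with `α = a/s`, `γ = (a/2 + b)/s − α²/2` — the cumulant
  form consumed by the Berry–Esseen glue (`Literature.Probability.Independence.BerryEsseenComplexTilt`).

## Sources
N. R. Beaton et al., CMP 326 (2014), arXiv:1109.0358v5 §3.2 Proposition 6 (μ_T(y,z)); R. P. Stanley, EC1 §4.1; L. V. Ahlfors (1979) Ch. 4 §3.3, Ch. 5 §1.2
(Taylor).  Lane statements; nothing is quoted AS PRINTED.
-/

noncomputable section

open Set Metric Filter Complex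
open scoped Topology

namespace Literature.Probability.RandomPlanarGeometry.SAW.HexBW

namespace WidthOneYZ

variable {y z : ℝ}

/-! ## §1 The Taylor coefficients and the exact identity -/

/-- `a = y(s² − zs + z)/D`, `s = μ₁(y,z)²`, `D = (s−y)(s−z) + s(s−z) + s(s−y)`: the first `(e^{it} − 1)`-Taylor coefficient of the Perron root.
[cite: BeatonBousquetMelouDeGierDuminilCopinGuttmann2014, §3.2 Proposition 6 (lane definition)] -/
def perronTaylorA (y z : ℝ) : ℝ :=
  y * (stripMuY₂ 1 y z ^ 2 * stripMuY₂ 1 y z ^ 2 - z * stripMuY₂ 1 y z ^ 2 + z)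
    / ((stripMuY₂ 1 y z ^ 2 - y) * (stripMuY₂ 1 y z ^ 2 - z) + stripMuY₂ 1 y z ^ 2 * (stripMuY₂ 1 y z ^ 2 - z)
        + stripMuY₂ 1 y z ^ 2 * (stripMuY₂ 1 y z ^ 2 - y))

/-- `b = −((3s − z − y)a² − y(2s − z)a)/D`: the second `(e^{it} − 1)`-Taylor coefficient of the Perron root.
[cite: BeatonBousquetMelouDeGierDuminilCopinGuttmann2014, §3.2 Proposition 6 (lane definition)] -/
def perronTaylorB (y z : ℝ) : ℝ :=
  -((3 * stripMuY₂ 1 y z ^ 2 - z - y) * perronTaylorA y z ^ 2 - y * (2 * stripMuY₂ 1 y z ^ 2 - z) * perronTaylorA y z)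
    / ((stripMuY₂ 1 y z ^ 2 - y) * (stripMuY₂ 1 y z ^ 2 - z) + stripMuY₂ 1 y z ^ 2 * (stripMuY₂ 1 y z ^ 2 - z)
        + stripMuY₂ 1 y z ^ 2 * (stripMuY₂ 1 y z ^ 2 - y))

/-- `perronTaylor y z t = s + a(e^{it} − 1) + b(e^{it} − 1)²`. [cite: BeatonBousquetMelouDeGierDuminilCopinGuttmann2014, §3.2 Proposition 6 (lane definition)] -/
def perronTaylor (y z : ℝ) (t : ℝ) : ℂ :=
  ((stripMuY₂ 1 y z ^ 2 : ℝ) : ℂ) + (perronTaylorA y z : ℂ) * (cexp ((t : ℂ) * I) - 1)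
    + (perronTaylorB y z : ℂ) * (cexp ((t : ℂ) * I) - 1) ^ 2

/-- The defining relations: `D·a = y(s² − zs + z)` and `D·b + (3s − z − y)a² − y(2s − z)a = 0` (`D > 0` by `deriv_twoWallCubic_zero`).
[cite: BeatonBousquetMelouDeGierDuminilCopinGuttmann2014, §3.2 Proposition 6 (lane plumbing)] -/
theorem perronTaylor_relations (hy : 0 < y) (hz : 0 < z) :
    ((stripMuY₂ 1 y z ^ 2 - y) * (stripMuY₂ 1 y z ^ 2 - z) + stripMuY₂ 1 y z ^ 2 * (stripMuY₂ 1 y z ^ 2 - z)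
        + stripMuY₂ 1 y z ^ 2 * (stripMuY₂ 1 y z ^ 2 - y)) * perronTaylorA y z
      = y * (stripMuY₂ 1 y z ^ 2 * stripMuY₂ 1 y z ^ 2 - z * stripMuY₂ 1 y z ^ 2 + z) ∧
    ((stripMuY₂ 1 y z ^ 2 - y) * (stripMuY₂ 1 y z ^ 2 - z) + stripMuY₂ 1 y z ^ 2 * (stripMuY₂ 1 y z ^ 2 - z)
        + stripMuY₂ 1 y z ^ 2 * (stripMuY₂ 1 y z ^ 2 - y)) * perronTaylorB y z
      + (3 * stripMuY₂ 1 y z ^ 2 - z - y) * perronTaylorA y z ^ 2 - y * (2 * stripMuY₂ 1 y z ^ 2 - z) * perronTaylorA y z = 0 := by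
  obtain ⟨-, hD⟩ := deriv_twoWallCubic_zero hy hz
  constructor
  · unfold perronTaylorA
    rw [← mul_div_assoc, mul_div_cancel_left₀ _ hD.ne']
  · unfold perronTaylorB
    rw [← mul_div_assoc, mul_div_cancel_left₀ _ hD.ne']
    ring

/-- ★ **The exact Taylor identity**: with `V = e^{it} − 1`, `a`, `b` as above and `s = μ₁(y,z)²`,
`F(perronTaylor(t), t) = V³·(c₃ + c₄V + c₅V² + c₆V³)` where `c₃ = a³ + 6sab − 2zab − y(2ab + a² + 2sb − zb)`,
`c₄ = 3a²b + 3sb² − zb² − y(b² + 2ab)`, `c₅ = 3ab² − yb²`, `c₆ = b³` — the coefficients of `V⁰, V¹, V²` vanish by the cubic equation of `s` and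
the two defining relations. [cite: Ahlfors1979, Ch. 5 §1.2 (lane statement: Taylor coefficients of an implicit root)] -/
theorem twoWallCubic_perronTaylor (hy : 0 < y) (hz : 0 < z) (t : ℝ) :
    twoWallCubic y z (perronTaylor y z t) t
      = (cexp ((t : ℂ) * I) - 1) ^ 3 *
        (((perronTaylorA y z ^ 3 + 6 * stripMuY₂ 1 y z ^ 2 * perronTaylorA y z * perronTaylorB y z
              - 2 * z * perronTaylorA y z * perronTaylorB y z
              - y * (2 * perronTaylorA y z * perronTaylorB y z + perronTaylorA y z ^ 2
                  + 2 * stripMuY₂ 1 y z ^ 2 * perronTaylorB y z - z * perronTaylorB y z) : ℝ) : ℂ)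
          + ((3 * perronTaylorA y z ^ 2 * perronTaylorB y z + 3 * stripMuY₂ 1 y z ^ 2 * perronTaylorB y z ^ 2
              - z * perronTaylorB y z ^ 2 - y * (perronTaylorB y z ^ 2 + 2 * perronTaylorA y z * perronTaylorB y z) : ℝ) : ℂ)
            * (cexp ((t : ℂ) * I) - 1)
          + ((3 * perronTaylorA y z * perronTaylorB y z ^ 2 - y * perronTaylorB y z ^ 2 : ℝ) : ℂ) * (cexp ((t : ℂ) * I) - 1) ^ 2
          + ((perronTaylorB y z ^ 3 : ℝ) : ℂ) * (cexp ((t : ℂ) * I) - 1) ^ 3) := by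
  obtain ⟨h₁, h₂⟩ := perronTaylor_relations hy hz
  have h₀ := stripMuY₂_one_sq_poly_eq hy hz
  set s := stripMuY₂ 1 y z ^ 2 with hs
  set a := perronTaylorA y z
  set b := perronTaylorB y z
  have h₀' : (s : ℂ) ^ 3 - (z : ℂ) * (s : ℂ) ^ 2 - (y : ℂ) * ((s : ℂ) * (s : ℂ) - (z : ℂ) * (s : ℂ) + (z : ℂ)) = 0 := by
    have : (s : ℝ) ^ 3 - z * s ^ 2 - y * (s * s - z * s + z) = 0 := by linear_combination h₀
    exact_mod_cast this
  have h₁' : (((s - y) * (s - z) + s * (s - z) + s * (s - y) : ℝ) : ℂ) * (a : ℂ) = (y : ℂ) * ((s : ℂ) * (s : ℂ) - (z : ℂ) * (s : ℂ) + (z : ℂ)) := by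
    exact_mod_cast h₁
  have h₂' : (((s - y) * (s - z) + s * (s - z) + s * (s - y) : ℝ) : ℂ) * (b : ℂ)
      + ((3 * s - z - y : ℝ) : ℂ) * (a : ℂ) ^ 2 - (y : ℂ) * ((2 * s - z : ℝ) : ℂ) * (a : ℂ) = 0 := by
    exact_mod_cast h₂
  push_cast at h₁' h₂' ⊢
  unfold twoWallCubic perronTaylor
  rw [← hs]
  set V := cexp ((t : ℂ) * I) - 1 with hV
  have hu : cexp ((t : ℂ) * I) = V + 1 := by rw [hV]; ring
  rw [hu]
  linear_combination h₀' + V * h₁' + V ^ 2 * h₂'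

/-- Hence `‖F(perronTaylor(t), t)‖ ≤ K_H |t|³` for `|t| ≤ 1` (`|e^{it} − 1| ≤ |t|`), for some constant `K_H = K_H(y,z) ≥ 0`.
[cite: Ahlfors1979, Ch. 5 §1.2 (lane statement)] -/
theorem exists_norm_twoWallCubic_perronTaylor_le (hy : 0 < y) (hz : 0 < z) :
    ∃ K : ℝ, 0 ≤ K ∧ ∀ t : ℝ, |t| ≤ 1 → ‖twoWallCubic y z (perronTaylor y z t) t‖ ≤ K * |t| ^ 3 := by
  set s := stripMuY₂ 1 y z ^ 2 with hs
  set a := perronTaylorA y z with ha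
  set b := perronTaylorB y z with hb
  set c₃ : ℝ := a ^ 3 + 6 * s * a * b - 2 * z * a * b - y * (2 * a * b + a ^ 2 + 2 * s * b - z * b) with hc₃
  set c₄ : ℝ := 3 * a ^ 2 * b + 3 * s * b ^ 2 - z * b ^ 2 - y * (b ^ 2 + 2 * a * b) with hc₄
  set c₅ : ℝ := 3 * a * b ^ 2 - y * b ^ 2 with hc₅
  set c₆ : ℝ := b ^ 3 with hc₆
  refine ⟨|c₃| + |c₄| + |c₅| + |c₆|, by positivity, fun t ht => ?_⟩
  rw [twoWallCubic_perronTaylor hy hz t, ← hs, ← ha, ← hb]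
  set V := cexp ((t : ℂ) * I) - 1 with hV
  have hVt : ‖V‖ ≤ |t| := by
    have h := Real.norm_exp_I_mul_ofReal_sub_one_le (x := t)
    rw [mul_comm] at h
    rwa [Real.norm_eq_abs] at h
  have hV1 : ‖V‖ ≤ 1 := hVt.trans ht
  have ht0 : 0 ≤ |t| := abs_nonneg t
  have hH : ‖((c₃ : ℝ) : ℂ) + ((c₄ : ℝ) : ℂ) * V + ((c₅ : ℝ) : ℂ) * V ^ 2 + ((c₆ : ℝ) : ℂ) * V ^ 3‖
      ≤ |c₃| + |c₄| + |c₅| + |c₆| := by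
    have e3 : ‖((c₃ : ℝ) : ℂ)‖ = |c₃| := by rw [Complex.norm_real, Real.norm_eq_abs]
    have e4 : ‖((c₄ : ℝ) : ℂ) * V‖ ≤ |c₄| := by
      rw [norm_mul, Complex.norm_real, Real.norm_eq_abs]
      exact mul_le_of_le_one_right (abs_nonneg _) hV1
    have e5 : ‖((c₅ : ℝ) : ℂ) * V ^ 2‖ ≤ |c₅| := by
      rw [norm_mul, Complex.norm_real, Real.norm_eq_abs, norm_pow]
      exact mul_le_of_le_one_right (abs_nonneg _) (pow_le_one₀ (norm_nonneg _) hV1)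
    have e6 : ‖((c₆ : ℝ) : ℂ) * V ^ 3‖ ≤ |c₆| := by
      rw [norm_mul, Complex.norm_real, Real.norm_eq_abs, norm_pow]
      exact mul_le_of_le_one_right (abs_nonneg _) (pow_le_one₀ (norm_nonneg _) hV1)
    calc ‖((c₃ : ℝ) : ℂ) + ((c₄ : ℝ) : ℂ) * V + ((c₅ : ℝ) : ℂ) * V ^ 2 + ((c₆ : ℝ) : ℂ) * V ^ 3‖
        ≤ ‖((c₃ : ℝ) : ℂ)‖ + ‖((c₄ : ℝ) : ℂ) * V‖ + ‖((c₅ : ℝ) : ℂ) * V ^ 2‖ + ‖((c₆ : ℝ) : ℂ) * V ^ 3‖ := by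
          have i1 := norm_add_le (((c₃ : ℝ) : ℂ) + ((c₄ : ℝ) : ℂ) * V + ((c₅ : ℝ) : ℂ) * V ^ 2) (((c₆ : ℝ) : ℂ) * V ^ 3)
          have i2 := norm_add_le (((c₃ : ℝ) : ℂ) + ((c₄ : ℝ) : ℂ) * V) (((c₅ : ℝ) : ℂ) * V ^ 2)
          have i3 := norm_add_le (((c₃ : ℝ) : ℂ)) (((c₄ : ℝ) : ℂ) * V)
          linarith
      _ ≤ |c₃| + |c₄| + |c₅| + |c₆| := by rw [e3]; linarith [e4, e5, e6]
  have hcast : (((a ^ 3 + 6 * s * a * b - 2 * z * a * b - y * (2 * a * b + a ^ 2 + 2 * s * b - z * b) : ℝ)) : ℂ)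
        + ((3 * a ^ 2 * b + 3 * s * b ^ 2 - z * b ^ 2 - y * (b ^ 2 + 2 * a * b) : ℝ) : ℂ) * V
        + ((3 * a * b ^ 2 - y * b ^ 2 : ℝ) : ℂ) * V ^ 2 + ((b ^ 3 : ℝ) : ℂ) * V ^ 3
      = ((c₃ : ℝ) : ℂ) + ((c₄ : ℝ) : ℂ) * V + ((c₅ : ℝ) : ℂ) * V ^ 2 + ((c₆ : ℝ) : ℂ) * V ^ 3 := by
    rw [hc₃, hc₄, hc₅, hc₆]
  rw [hcast, norm_mul, norm_pow]
  calc ‖V‖ ^ 3 * ‖((c₃ : ℝ) : ℂ) + ((c₄ : ℝ) : ℂ) * V + ((c₅ : ℝ) : ℂ) * V ^ 2 + ((c₆ : ℝ) : ℂ) * V ^ 3‖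
      ≤ |t| ^ 3 * (|c₃| + |c₄| + |c₅| + |c₆|) :=
        mul_le_mul (pow_le_pow_left₀ (norm_nonneg _) hVt 3) hH (norm_nonneg _) (by positivity)
    _ = (|c₃| + |c₄| + |c₅| + |c₆|) * |t| ^ 3 := by ring

/-! ## §2 The divided difference of the cubic -/

/-- `F(ω₁,t) − F(ω₂,t) = (ω₁ − ω₂)·Q`, `Q = ω₁² + ω₁ω₂ + ω₂² − (ye^{it} + z)(ω₁ + ω₂) + ye^{it}z`.
[cite: Stanley2012EC1, §4.1 (lane plumbing)] -/
theorem twoWallCubic_sub_eq_mul_dividedDiff (y z : ℝ) (ω₁ ω₂ : ℂ) (t : ℝ) :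
    twoWallCubic y z ω₁ t - twoWallCubic y z ω₂ t
      = (ω₁ - ω₂) * (ω₁ ^ 2 + ω₁ * ω₂ + ω₂ ^ 2 - ((y : ℂ) * cexp ((t : ℂ) * I) + (z : ℂ)) * (ω₁ + ω₂)
          + (y : ℂ) * cexp ((t : ℂ) * I) * (z : ℂ)) := by
  unfold twoWallCubic; ring

/-- Near `(s, s, t = 0)` the divided difference is close to `D = F_ω(s,0) = 3s² − 2(y+z)s + yz`: if `‖ω₁ − s‖, ‖ω₂ − s‖ ≤ ε ≤ 1` and
`‖e^{it} − 1‖ ≤ τ ≤ 1` then `‖Q − D‖ ≤ (6s − 2z + 3)ε + y(2s + z)τ` (`s = μ₁(y,z)²`).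
[cite: Ahlfors1979, Ch. 4 §3.3 (lane plumbing)] -/
theorem norm_dividedDiff_sub_le (hy : 0 < y) (hz : 0 < z) {ω₁ ω₂ : ℂ} {t ε τ : ℝ}
    (h₁ : ‖ω₁ - ((stripMuY₂ 1 y z ^ 2 : ℝ) : ℂ)‖ ≤ ε) (h₂ : ‖ω₂ - ((stripMuY₂ 1 y z ^ 2 : ℝ) : ℂ)‖ ≤ ε) (hε1 : ε ≤ 1)
    (hV : ‖cexp ((t : ℂ) * I) - 1‖ ≤ τ) (hτ1 : τ ≤ 1) :
    ‖(ω₁ ^ 2 + ω₁ * ω₂ + ω₂ ^ 2 - ((y : ℂ) * cexp ((t : ℂ) * I) + (z : ℂ)) * (ω₁ + ω₂) + (y : ℂ) * cexp ((t : ℂ) * I) * (z : ℂ))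
        - (((stripMuY₂ 1 y z ^ 2 - y) * (stripMuY₂ 1 y z ^ 2 - z) + stripMuY₂ 1 y z ^ 2 * (stripMuY₂ 1 y z ^ 2 - z)
            + stripMuY₂ 1 y z ^ 2 * (stripMuY₂ 1 y z ^ 2 - y) : ℝ) : ℂ)‖
      ≤ (6 * stripMuY₂ 1 y z ^ 2 - 2 * z + 3) * ε + y * (2 * stripMuY₂ 1 y z ^ 2 + z) * τ := by
  set s := stripMuY₂ 1 y z ^ 2 with hs
  obtain ⟨hsy, hsz⟩ := lt_stripMuY₂_one_sq₂ hy hz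
  have hs0 : 0 < s := lt_trans hy hsy
  have hε0 : 0 ≤ ε := le_trans (norm_nonneg _) h₁
  have hτ0 : 0 ≤ τ := le_trans (norm_nonneg _) hV
  set e₁ := ω₁ - (s : ℂ) with he₁
  set e₂ := ω₂ - (s : ℂ) with he₂
  set V := cexp ((t : ℂ) * I) - 1 with hVdef
  have eω₁ : ω₁ = (s : ℂ) + e₁ := by rw [he₁]; ring
  have eω₂ : ω₂ = (s : ℂ) + e₂ := by rw [he₂]; ring
  have eu : cexp ((t : ℂ) * I) = 1 + V := by rw [hVdef]; ring
  have e : (ω₁ ^ 2 + ω₁ * ω₂ + ω₂ ^ 2 - ((y : ℂ) * cexp ((t : ℂ) * I) + (z : ℂ)) * (ω₁ + ω₂) + (y : ℂ) * cexp ((t : ℂ) * I) * (z : ℂ))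
        - (((s - y) * (s - z) + s * (s - z) + s * (s - y) : ℝ) : ℂ)
      = (e₁ + e₂) * (((3 * s - y - z : ℝ) : ℂ) + e₁ - (y : ℂ) * V) + e₂ ^ 2 + V * (((y * (z - 2 * s) : ℝ)) : ℂ) := by
    rw [eω₁, eω₂, eu]; push_cast; ring
  rw [e]
  have h3 : 0 < 3 * s - y - z := by linarith
  have hA : ‖((3 * s - y - z : ℝ) : ℂ) + e₁ - (y : ℂ) * V‖ ≤ (3 * s - y - z) + ε + y * τ := by
    calc ‖((3 * s - y - z : ℝ) : ℂ) + e₁ - (y : ℂ) * V‖ ≤ ‖((3 * s - y - z : ℝ) : ℂ) + e₁‖ + ‖(y : ℂ) * V‖ := norm_sub_le _ _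
      _ ≤ ‖((3 * s - y - z : ℝ) : ℂ)‖ + ‖e₁‖ + ‖(y : ℂ) * V‖ := by linarith [norm_add_le (((3 * s - y - z : ℝ) : ℂ)) e₁]
      _ ≤ (3 * s - y - z) + ε + y * τ := by
          rw [Complex.norm_real, Real.norm_of_nonneg h3.le, norm_mul, Complex.norm_real, Real.norm_of_nonneg hy.le]
          linarith [mul_le_mul_of_nonneg_left hV hy.le]
  have hB : ‖V * (((y * (z - 2 * s) : ℝ)) : ℂ)‖ ≤ τ * (y * (2 * s - z)) := by
    rw [norm_mul, Complex.norm_real, Real.norm_eq_abs, show |y * (z - 2 * s)| = y * (2 * s - z) by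
      rw [abs_mul, abs_of_pos hy, abs_of_nonpos (by linarith)]; ring]
    exact mul_le_mul_of_nonneg_right hV (by nlinarith)
  have h12 : ‖e₁ + e₂‖ ≤ 2 * ε := by linarith [norm_add_le e₁ e₂]
  have hsq : ‖e₂ ^ 2‖ ≤ ε := by
    rw [norm_pow]
    nlinarith [norm_nonneg e₂]
  calc ‖(e₁ + e₂) * (((3 * s - y - z : ℝ) : ℂ) + e₁ - (y : ℂ) * V) + e₂ ^ 2 + V * (((y * (z - 2 * s) : ℝ)) : ℂ)‖
      ≤ ‖(e₁ + e₂) * (((3 * s - y - z : ℝ) : ℂ) + e₁ - (y : ℂ) * V)‖ + ‖e₂ ^ 2‖ + ‖V * (((y * (z - 2 * s) : ℝ)) : ℂ)‖ := by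
        have i1 := norm_add_le ((e₁ + e₂) * (((3 * s - y - z : ℝ) : ℂ) + e₁ - (y : ℂ) * V) + e₂ ^ 2) (V * (((y * (z - 2 * s) : ℝ)) : ℂ))
        have i2 := norm_add_le ((e₁ + e₂) * (((3 * s - y - z : ℝ) : ℂ) + e₁ - (y : ℂ) * V)) (e₂ ^ 2)
        linarith
    _ ≤ 2 * ε * ((3 * s - y - z) + ε + y * τ) + ε + τ * (y * (2 * s - z)) := by
        rw [norm_mul]
        have := mul_le_mul h12 hA (norm_nonneg _) (by positivity)
        linarith
    _ ≤ (6 * s - 2 * z + 3) * ε + y * (2 * s + z) * τ := by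
        nlinarith [mul_nonneg hε0 (sub_nonneg.2 hε1), mul_nonneg (mul_nonneg hy.le hε0) (sub_nonneg.2 hτ1),
          mul_nonneg (mul_nonneg hy.le hz.le) hτ0]

/-! ## §3 The root to third order -/
set_option maxHeartbeats 400000 in
/-- ★★ **THE PERRON ROOT TO SECOND ORDER WITH CUBIC REMAINDER.**  For every `L` there are `t₁ > 0` and `K` such that, for real `|t| < t₁`,
every root `s'` of `F(·,t)` with `‖s' − s‖ ≤ L|t|` (`exists_complexPerronRoot` / `…ComplexPerronData` supply such roots) satisfies
`‖s' − (s + a(e^{it} − 1) + b(e^{it} − 1)²)‖ ≤ K|t|³`.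
[cite: BeatonBousquetMelouDeGierDuminilCopinGuttmann2014, §3.2 Proposition 6 (lane statement); Ahlfors1979, Ch. 5 §1.2] -/
theorem exists_norm_root_sub_perronTaylor_le (hy : 0 < y) (hz : 0 < z) (L : ℝ) :
    ∃ t₁ > 0, ∃ K : ℝ, 0 ≤ K ∧ ∀ t : ℝ, |t| < t₁ → ∀ s' : ℂ, twoWallCubic y z s' t = 0 →
      ‖s' - ((stripMuY₂ 1 y z ^ 2 : ℝ) : ℂ)‖ ≤ L * |t| → ‖s' - perronTaylor y z t‖ ≤ K * |t| ^ 3 := by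
  set s := stripMuY₂ 1 y z ^ 2 with hs
  obtain ⟨hsy, hsz⟩ := lt_stripMuY₂_one_sq₂ hy hz
  have hs0 : 0 < s := lt_trans hy hsy
  obtain ⟨-, hD⟩ := deriv_twoWallCubic_zero hy hz
  rw [← hs] at hD
  set D := (s - y) * (s - z) + s * (s - z) + s * (s - y) with hDdef
  obtain ⟨KH, hKH0, hKH⟩ := exists_norm_twoWallCubic_perronTaylor_le hy hz
  set a := perronTaylorA y z with ha
  set b := perronTaylorB y z with hb
  set A := |a| + |b| with hA
  set M₁ := 6 * s - 2 * z + 3 with hM₁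
  set M₂ := y * (2 * s + z) with hM₂
  have hM₁0 : 0 < M₁ := by rw [hM₁]; linarith
  have hM₂0 : 0 < M₂ := by rw [hM₂]; positivity
  set L' := max L 0 with hL'
  have hL'0 : 0 ≤ L' := le_max_right _ _
  set ε := min 1 (D / (4 * M₁)) with hε
  have hε0 : 0 < ε := lt_min one_pos (by positivity)
  have hε1 : ε ≤ 1 := min_le_left _ _
  set t₁ := min (min 1 (D / (4 * M₂ + 1))) (min (ε / (L' + 1)) (ε / (A + 1))) with ht₁
  have hA0 : 0 ≤ A := by rw [hA]; positivity
  refine ⟨t₁, lt_min (lt_min one_pos (by positivity)) (lt_min (by positivity) (by positivity)), 2 * KH / D, by positivity,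
    fun t ht s' hF hL => ?_⟩
  have ht0 : 0 ≤ |t| := abs_nonneg t
  have ht1 : |t| ≤ 1 := (le_of_lt ht).trans ((min_le_left _ _).trans (min_le_left _ _))
  have htM : |t| ≤ D / (4 * M₂ + 1) := (le_of_lt ht).trans ((min_le_left _ _).trans (min_le_right _ _))
  have htL : |t| ≤ ε / (L' + 1) := (le_of_lt ht).trans ((min_le_right _ _).trans (min_le_left _ _))
  have htA : |t| ≤ ε / (A + 1) := (le_of_lt ht).trans ((min_le_right _ _).trans (min_le_right _ _))
  set V := cexp ((t : ℂ) * I) - 1 with hVdef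
  have hVt : ‖V‖ ≤ |t| := by
    have h := Real.norm_exp_I_mul_ofReal_sub_one_le (x := t)
    rw [mul_comm] at h
    rwa [Real.norm_eq_abs] at h
  -- the two points are `ε`-close to `s`
  have h1 : ‖s' - (s : ℂ)‖ ≤ ε := by
    calc ‖s' - (s : ℂ)‖ ≤ L * |t| := hL
      _ ≤ L' * |t| := mul_le_mul_of_nonneg_right (le_max_left _ _) ht0
      _ ≤ L' * (ε / (L' + 1)) := mul_le_mul_of_nonneg_left htL hL'0
      _ ≤ ε := by
          rw [mul_div_assoc', div_le_iff₀ (by positivity)]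
          nlinarith [hε0]
  have h2 : ‖perronTaylor y z t - (s : ℂ)‖ ≤ ε := by
    have e : perronTaylor y z t - (s : ℂ) = (a : ℂ) * V + (b : ℂ) * V ^ 2 := by
      unfold perronTaylor; rw [← hs, ← ha, ← hb, ← hVdef]; ring
    rw [e]
    calc ‖(a : ℂ) * V + (b : ℂ) * V ^ 2‖ ≤ ‖(a : ℂ) * V‖ + ‖(b : ℂ) * V ^ 2‖ := norm_add_le _ _
      _ ≤ |a| * |t| + |b| * |t| := by
          rw [norm_mul, norm_mul, norm_pow, Complex.norm_real, Complex.norm_real, Real.norm_eq_abs, Real.norm_eq_abs]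
          have hV2 : ‖V‖ ^ 2 ≤ |t| := by nlinarith [norm_nonneg V, hVt, ht1]
          exact add_le_add (mul_le_mul_of_nonneg_left hVt (abs_nonneg _)) (mul_le_mul_of_nonneg_left hV2 (abs_nonneg _))
      _ = A * |t| := by rw [hA]; ring
      _ ≤ A * (ε / (A + 1)) := mul_le_mul_of_nonneg_left htA hA0
      _ ≤ ε := by
          rw [mul_div_assoc', div_le_iff₀ (by positivity)]
          nlinarith [hε0]
  -- the divided difference is `≥ D/2`
  have hQD := norm_dividedDiff_sub_le hy hz (t := t) h1 h2 hε1 hVt ht1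
  rw [← hs] at hQD
  set Q := s' ^ 2 + s' * perronTaylor y z t + perronTaylor y z t ^ 2
      - ((y : ℂ) * cexp ((t : ℂ) * I) + (z : ℂ)) * (s' + perronTaylor y z t) + (y : ℂ) * cexp ((t : ℂ) * I) * (z : ℂ) with hQ
  have hsmall : (6 * s - 2 * z + 3) * ε + y * (2 * s + z) * |t| ≤ D / 2 := by
    have i1 : M₁ * ε ≤ D / 4 := by
      calc M₁ * ε ≤ M₁ * (D / (4 * M₁)) := mul_le_mul_of_nonneg_left (min_le_right _ _) hM₁0.le
        _ = D / 4 := by field_simp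
    have i2 : M₂ * |t| ≤ D / 4 := by
      calc M₂ * |t| ≤ M₂ * (D / (4 * M₂ + 1)) := mul_le_mul_of_nonneg_left htM hM₂0.le
        _ ≤ D / 4 := by
            rw [mul_div_assoc', div_le_iff₀ (by positivity)]
            nlinarith [hD, hM₂0]
    rw [← hM₁, ← hM₂]; linarith
  have hQ2 : D / 2 ≤ ‖Q‖ := by
    have hDn : ‖((D : ℝ) : ℂ)‖ = D := by rw [Complex.norm_real, Real.norm_of_nonneg hD.le]
    have := norm_sub_norm_le ((D : ℝ) : ℂ) Q
    rw [hDn, ← norm_neg (((D : ℝ) : ℂ) - Q), neg_sub] at this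
    have hQD' : ‖Q - ((D : ℝ) : ℂ)‖ ≤ D / 2 := by rw [hQ, hDdef]; push_cast at hQD ⊢; linarith [hQD]
    linarith
  -- `(s' − P)·Q = −F(P,t)`
  have hdiff := twoWallCubic_sub_eq_mul_dividedDiff y z s' (perronTaylor y z t) t
  rw [hF, zero_sub, ← hQ] at hdiff
  have hnorm : ‖s' - perronTaylor y z t‖ * ‖Q‖ = ‖twoWallCubic y z (perronTaylor y z t) t‖ := by
    rw [← norm_mul, ← hdiff, norm_neg]
  have hFP := hKH t ht1
  have hQpos : 0 < ‖Q‖ := lt_of_lt_of_le (by positivity) hQ2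
  calc ‖s' - perronTaylor y z t‖ = ‖twoWallCubic y z (perronTaylor y z t) t‖ / ‖Q‖ := by
        rw [← hnorm, mul_div_cancel_right₀ _ hQpos.ne']
    _ ≤ KH * |t| ^ 3 / (D / 2) := div_le_div₀ (by positivity) hFP (by positivity) hQ2
    _ = 2 * KH / D * |t| ^ 3 := by field_simp

/-! ## §4 Polynomial and logarithmic forms -/

/-- `‖(e^{it} − 1)² + t²‖ ≤ 2|t|³` for real `|t| ≤ 1` (`(e^{it} − 1)² + t² = (e^{it} − 1 − it)(e^{it} − 1 + it)`, Mathlib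
`Complex.norm_exp_sub_one_sub_id_le`; the companion `‖e^{it} − 1 − it + t²/2‖ ≤ |t|³` IS the tree's
`Literature.Probability.Independence.norm_cexp_mul_I_sub_taylor_two_le`). [cite: Ahlfors1979, Ch. 5 §1.2 (lane plumbing)] -/
theorem norm_cexp_sub_one_sq_add_sq_le {t : ℝ} (ht : |t| ≤ 1) :
    ‖(cexp ((t : ℂ) * I) - 1) ^ 2 + (t : ℂ) ^ 2‖ ≤ 2 * |t| ^ 3 := by
  set x := (t : ℂ) * I with hx
  have hxn : ‖x‖ = |t| := by rw [hx, norm_mul, Complex.norm_I, mul_one, Complex.norm_real, Real.norm_eq_abs]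
  have hx1 : ‖x‖ ≤ 1 := hxn ▸ ht
  have hx2 : x ^ 2 = -((t : ℂ) ^ 2) := by rw [hx, mul_pow, Complex.I_sq]; ring
  have ht0 : 0 ≤ |t| := abs_nonneg t
  have e : (cexp x - 1) ^ 2 + (t : ℂ) ^ 2 = (cexp x - 1 - x) * (cexp x - 1 + x) := by
    have : (t : ℂ) ^ 2 = -(x ^ 2) := by rw [hx2, neg_neg]
    rw [this]; ring
  rw [e, norm_mul]
  have h1 : ‖cexp x - 1 - x‖ ≤ ‖x‖ ^ 2 := Complex.norm_exp_sub_one_sub_id_le hx1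
  have h2 : ‖cexp x - 1 + x‖ ≤ 2 * |t| := by
    have hV : ‖cexp x - 1‖ ≤ |t| := by
      have h := Real.norm_exp_I_mul_ofReal_sub_one_le (x := t)
      rw [mul_comm] at h
      rwa [Real.norm_eq_abs] at h
    calc ‖cexp x - 1 + x‖ ≤ ‖cexp x - 1‖ + ‖x‖ := norm_add_le _ _
      _ ≤ 2 * |t| := by rw [hxn]; linarith
  calc ‖cexp x - 1 - x‖ * ‖cexp x - 1 + x‖ ≤ ‖x‖ ^ 2 * (2 * |t|) := mul_le_mul h1 h2 (norm_nonneg _) (by positivity)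
    _ = 2 * |t| ^ 3 := by rw [hxn]; ring

/-- ★ **Polynomial form**: for every `L` there are `t₁ > 0`, `K` with: `|t| < t₁`, `F(s',t) = 0`, `‖s' − s‖ ≤ L|t|` ⇒
`‖s' − (s + i a t − (a/2 + b)t²)‖ ≤ K|t|³` (`a = perronTaylorA`, `b = perronTaylorB`).
[cite: BeatonBousquetMelouDeGierDuminilCopinGuttmann2014, §3.2 Proposition 6 (lane statement); Ahlfors1979, Ch. 5 §1.2] -/
theorem exists_norm_root_sub_quadratic_le (hy : 0 < y) (hz : 0 < z) (L : ℝ) :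
    ∃ t₁ > 0, ∃ K : ℝ, 0 ≤ K ∧ ∀ t : ℝ, |t| < t₁ → ∀ s' : ℂ, twoWallCubic y z s' t = 0 →
      ‖s' - ((stripMuY₂ 1 y z ^ 2 : ℝ) : ℂ)‖ ≤ L * |t| →
      ‖s' - (((stripMuY₂ 1 y z ^ 2 : ℝ) : ℂ) + (perronTaylorA y z : ℂ) * ((t : ℂ) * I)
              - ((perronTaylorA y z / 2 + perronTaylorB y z : ℝ) : ℂ) * (t : ℂ) ^ 2)‖ ≤ K * |t| ^ 3 := by
  obtain ⟨t₁, ht₁, K, hK0, H⟩ := exists_norm_root_sub_perronTaylor_le hy hz L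
  refine ⟨min t₁ 1, lt_min ht₁ one_pos, K + |perronTaylorA y z| + 2 * |perronTaylorB y z|, by positivity,
    fun t ht s' hF hL => ?_⟩
  obtain ⟨htt, ht1⟩ := lt_min_iff.mp ht
  have h := H t htt s' hF hL
  have e1 : ‖cexp ((t : ℂ) * I) - 1 - (t : ℂ) * I + (t : ℂ) ^ 2 / 2‖ ≤ |t| ^ 3 :=
    (Literature.Probability.Independence.norm_cexp_mul_I_sub_taylor_two_le t).trans (min_le_right _ _)
  have e2 := norm_cexp_sub_one_sq_add_sq_le ht1.le
  set a := perronTaylorA y z with ha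
  set b := perronTaylorB y z with hb
  have e : s' - (((stripMuY₂ 1 y z ^ 2 : ℝ) : ℂ) + (a : ℂ) * ((t : ℂ) * I) - ((a / 2 + b : ℝ) : ℂ) * (t : ℂ) ^ 2)
      = (s' - perronTaylor y z t) + ((a : ℂ) * (cexp ((t : ℂ) * I) - 1 - (t : ℂ) * I + (t : ℂ) ^ 2 / 2)
          + (b : ℂ) * ((cexp ((t : ℂ) * I) - 1) ^ 2 + (t : ℂ) ^ 2)) := by
    unfold perronTaylor; rw [← ha, ← hb]; push_cast; ring
  rw [e]
  have ht0 : 0 ≤ |t| := abs_nonneg t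
  calc ‖(s' - perronTaylor y z t) + ((a : ℂ) * (cexp ((t : ℂ) * I) - 1 - (t : ℂ) * I + (t : ℂ) ^ 2 / 2)
          + (b : ℂ) * ((cexp ((t : ℂ) * I) - 1) ^ 2 + (t : ℂ) ^ 2))‖
      ≤ ‖s' - perronTaylor y z t‖ + (‖(a : ℂ) * (cexp ((t : ℂ) * I) - 1 - (t : ℂ) * I + (t : ℂ) ^ 2 / 2)‖
          + ‖(b : ℂ) * ((cexp ((t : ℂ) * I) - 1) ^ 2 + (t : ℂ) ^ 2)‖) := by
        have i1 := norm_add_le (s' - perronTaylor y z t) ((a : ℂ) * (cexp ((t : ℂ) * I) - 1 - (t : ℂ) * I + (t : ℂ) ^ 2 / 2)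
          + (b : ℂ) * ((cexp ((t : ℂ) * I) - 1) ^ 2 + (t : ℂ) ^ 2))
        have i2 := norm_add_le ((a : ℂ) * (cexp ((t : ℂ) * I) - 1 - (t : ℂ) * I + (t : ℂ) ^ 2 / 2))
          ((b : ℂ) * ((cexp ((t : ℂ) * I) - 1) ^ 2 + (t : ℂ) ^ 2))
        linarith
    _ ≤ K * |t| ^ 3 + (|a| * |t| ^ 3 + |b| * (2 * |t| ^ 3)) := by
        rw [norm_mul, norm_mul, Complex.norm_real, Complex.norm_real, Real.norm_eq_abs, Real.norm_eq_abs]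
        exact add_le_add h (add_le_add (mul_le_mul_of_nonneg_left e1 (abs_nonneg _)) (mul_le_mul_of_nonneg_left e2 (abs_nonneg _)))
    _ = (K + |a| + 2 * |b|) * |t| ^ 3 := by ring

/-- ★★ **LOGARITHMIC (CUMULANT) FORM — the input of the Berry–Esseen glue.**  With `α = a/s`, `β = (a/2 + b)/s`, `γ = β − α²/2`: for every `L`
there are `t₂ > 0`, `K` with: `|t| < t₂`, `F(s',t) = 0`, `‖s' − s‖ ≤ L|t|` ⇒ `‖log(s'/s) − iαt + γt²‖ ≤ K|t|³`
(`log(1 + w) = w − w²/2 + O(|w|³)`, Mathlib `Complex.norm_log_sub_logTaylor_le`).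
[cite: BeatonBousquetMelouDeGierDuminilCopinGuttmann2014, §3.2 Proposition 6 (lane statement); Ahlfors1979, Ch. 5 §1.2] -/
theorem exists_norm_log_root_div_sub_le (hy : 0 < y) (hz : 0 < z) (L : ℝ) :
    ∃ t₂ > 0, ∃ K : ℝ, 0 ≤ K ∧ ∀ t : ℝ, |t| < t₂ → ∀ s' : ℂ, twoWallCubic y z s' t = 0 →
      ‖s' - ((stripMuY₂ 1 y z ^ 2 : ℝ) : ℂ)‖ ≤ L * |t| →
      ‖Complex.log (s' / ((stripMuY₂ 1 y z ^ 2 : ℝ) : ℂ))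
          - ((perronTaylorA y z / stripMuY₂ 1 y z ^ 2 : ℝ) : ℂ) * ((t : ℂ) * I)
          + (((perronTaylorA y z / 2 + perronTaylorB y z) / stripMuY₂ 1 y z ^ 2
              - (perronTaylorA y z / stripMuY₂ 1 y z ^ 2) ^ 2 / 2 : ℝ) : ℂ) * (t : ℂ) ^ 2‖ ≤ K * |t| ^ 3 := by
  set s := stripMuY₂ 1 y z ^ 2 with hs
  obtain ⟨hsy, -⟩ := lt_stripMuY₂_one_sq₂ hy hz
  have hs0 : 0 < s := lt_trans hy hsy
  have hsC : (s : ℂ) ≠ 0 := by exact_mod_cast hs0.ne'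
  obtain ⟨t₁, ht₁, K₁, hK₁0, H⟩ := exists_norm_root_sub_quadratic_le hy hz L
  rw [← hs] at H
  set a := perronTaylorA y z with ha
  set b := perronTaylorB y z with hb
  set α := a / s with hα
  set β := (a / 2 + b) / s with hβ
  set Cw := |α| + |β| + K₁ / s with hCw
  have hCw0 : 0 ≤ Cw := by rw [hCw]; positivity
  set t₂ := min (min t₁ 1) (1 / (2 * Cw + 1)) with ht₂
  refine ⟨t₂, lt_min (lt_min ht₁ one_pos) (by positivity),
    Cw ^ 3 + K₁ / s + (|β| + K₁ / s) * (Cw + |α|), by positivity, fun t ht s' hF hL => ?_⟩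
  have htt : |t| < t₁ := lt_of_lt_of_le ht ((min_le_left _ _).trans (min_le_left _ _))
  have ht1 : |t| ≤ 1 := (le_of_lt ht).trans ((min_le_left _ _).trans (min_le_right _ _))
  have htC : |t| ≤ 1 / (2 * Cw + 1) := (le_of_lt ht).trans (min_le_right _ _)
  have ht0 : 0 ≤ |t| := abs_nonneg t
  -- `s' = s + i a t − (a/2 + b)t² + E`, `‖E‖ ≤ K₁|t|³`
  set E := s' - ((s : ℂ) + (a : ℂ) * ((t : ℂ) * I) - ((a / 2 + b : ℝ) : ℂ) * (t : ℂ) ^ 2) with hE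
  have hEn : ‖E‖ ≤ K₁ * |t| ^ 3 := H t htt s' hF hL
  -- `w = s'/s − 1 = iαt − βt² + E/s`
  set w := s' / (s : ℂ) - 1 with hw
  have hw_eq : w = (α : ℂ) * ((t : ℂ) * I) - (β : ℂ) * (t : ℂ) ^ 2 + E / (s : ℂ) := by
    rw [hw, hE, hα, hβ]; push_cast; field_simp; ring
  have hxn : ‖(t : ℂ) * I‖ = |t| := by rw [norm_mul, Complex.norm_I, mul_one, Complex.norm_real, Real.norm_eq_abs]
  have ht2n : ‖((t : ℂ)) ^ 2‖ = |t| ^ 2 := by rw [norm_pow, Complex.norm_real, Real.norm_eq_abs]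
  have hEs : ‖E / (s : ℂ)‖ ≤ K₁ / s * |t| ^ 3 := by
    rw [norm_div, Complex.norm_real, Real.norm_of_nonneg hs0.le, div_le_iff₀ hs0]
    calc ‖E‖ ≤ K₁ * |t| ^ 3 := hEn
      _ = K₁ / s * |t| ^ 3 * s := by field_simp
  have ht2 : |t| ^ 2 ≤ |t| := pow_le_of_le_one ht0 ht1 (by norm_num)
  -- `‖w − iαt‖ ≤ (|β| + K₁/s) t²`, `‖w‖ ≤ Cw |t| ≤ 1/2`
  have hw1 : ‖w - (α : ℂ) * ((t : ℂ) * I)‖ ≤ (|β| + K₁ / s) * |t| ^ 2 := by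
    have e : w - (α : ℂ) * ((t : ℂ) * I) = -((β : ℂ) * (t : ℂ) ^ 2) + E / (s : ℂ) := by rw [hw_eq]; ring
    rw [e]
    calc ‖-((β : ℂ) * (t : ℂ) ^ 2) + E / (s : ℂ)‖ ≤ ‖-((β : ℂ) * (t : ℂ) ^ 2)‖ + ‖E / (s : ℂ)‖ := norm_add_le _ _
      _ ≤ |β| * |t| ^ 2 + K₁ / s * |t| ^ 3 := by
          rw [norm_neg, norm_mul, Complex.norm_real, Real.norm_eq_abs, ht2n]
          linarith [hEs]
      _ ≤ (|β| + K₁ / s) * |t| ^ 2 := by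
          have : K₁ / s * |t| ^ 3 ≤ K₁ / s * |t| ^ 2 :=
            mul_le_mul_of_nonneg_left (pow_le_pow_of_le_one ht0 ht1 (by norm_num)) (by positivity)
          linarith
  have hwn : ‖w‖ ≤ Cw * |t| := by
    have : ‖w‖ ≤ ‖w - (α : ℂ) * ((t : ℂ) * I)‖ + ‖(α : ℂ) * ((t : ℂ) * I)‖ := by
      have := norm_add_le (w - (α : ℂ) * ((t : ℂ) * I)) ((α : ℂ) * ((t : ℂ) * I))
      rwa [sub_add_cancel] at this
    rw [norm_mul, Complex.norm_real, Real.norm_eq_abs, hxn] at this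
    have h2 : (|β| + K₁ / s) * |t| ^ 2 ≤ (|β| + K₁ / s) * |t| := mul_le_mul_of_nonneg_left ht2 (by positivity)
    rw [hCw]; linarith [hw1]
  have hw2 : ‖w‖ ≤ 1 / 2 := by
    calc ‖w‖ ≤ Cw * |t| := hwn
      _ ≤ Cw * (1 / (2 * Cw + 1)) := mul_le_mul_of_nonneg_left htC hCw0
      _ ≤ 1 / 2 := by rw [mul_div_assoc', div_le_iff₀ (by positivity)]; linarith
  have hw_lt : ‖w‖ < 1 := lt_of_le_of_lt hw2 (by norm_num)
  -- the logarithm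
  have hlog_eq : Complex.log (s' / (s : ℂ)) = Complex.log (1 + w) := by rw [hw]; ring_nf
  have hT : Complex.logTaylor 3 w = w - w ^ 2 / 2 := by
    simp only [Complex.logTaylor, Finset.sum_range_succ, Finset.sum_range_zero, pow_zero, pow_one]
    push_cast
    ring
  have hrem : ‖Complex.log (1 + w) - (w - w ^ 2 / 2)‖ ≤ Cw ^ 3 * |t| ^ 3 := by
    have h := Complex.norm_log_sub_logTaylor_le 2 hw_lt
    rw [hT] at h
    have hinv : (1 - ‖w‖)⁻¹ ≤ 2 := by
      rw [inv_le_comm₀ (by linarith) (by norm_num)]; linarith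
    have hw3 : 0 ≤ ‖w‖ ^ 3 := pow_nonneg (norm_nonneg w) 3
    calc ‖Complex.log (1 + w) - (w - w ^ 2 / 2)‖ ≤ ‖w‖ ^ (2 + 1) * (1 - ‖w‖)⁻¹ / (2 + 1) := h
      _ ≤ ‖w‖ ^ (2 + 1) * 2 / (2 + 1) := by gcongr
      _ = ‖w‖ ^ 3 * (2 / 3) := by norm_num; ring
      _ ≤ ‖w‖ ^ 3 := by linarith only [hw3]
      _ ≤ (Cw * |t|) ^ 3 := pow_le_pow_left₀ (norm_nonneg _) hwn 3
      _ = Cw ^ 3 * |t| ^ 3 := by ring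
  -- the algebra: `(w − w²/2) − (iαt − γt²) = E/s − (w − iαt)(w + iαt)/2`
  have hγ : ((β - α ^ 2 / 2 : ℝ) : ℂ) = (β : ℂ) - (α : ℂ) ^ 2 / 2 := by push_cast; ring
  have halg : (w - w ^ 2 / 2) - ((α : ℂ) * ((t : ℂ) * I)) + ((β : ℂ) - (α : ℂ) ^ 2 / 2) * (t : ℂ) ^ 2
      = E / (s : ℂ) - (w - (α : ℂ) * ((t : ℂ) * I)) * (w + (α : ℂ) * ((t : ℂ) * I)) / 2 := by
    have hI : ((t : ℂ) * I) ^ 2 = -((t : ℂ) ^ 2) := by rw [mul_pow, Complex.I_sq]; ring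
    rw [hw_eq]
    linear_combination (-((α : ℂ) ^ 2 / 2)) * hI
  have hplus : ‖w + (α : ℂ) * ((t : ℂ) * I)‖ ≤ (Cw + |α|) * |t| := by
    calc ‖w + (α : ℂ) * ((t : ℂ) * I)‖ ≤ ‖w‖ + ‖(α : ℂ) * ((t : ℂ) * I)‖ := norm_add_le _ _
      _ ≤ Cw * |t| + |α| * |t| := by rw [norm_mul, Complex.norm_real, Real.norm_eq_abs, hxn]; linarith
      _ = (Cw + |α|) * |t| := by ring
  rw [hlog_eq, hγ]
  have esplit : Complex.log (1 + w) - (α : ℂ) * ((t : ℂ) * I) + ((β : ℂ) - (α : ℂ) ^ 2 / 2) * (t : ℂ) ^ 2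
      = (Complex.log (1 + w) - (w - w ^ 2 / 2))
        + ((w - w ^ 2 / 2) - ((α : ℂ) * ((t : ℂ) * I)) + ((β : ℂ) - (α : ℂ) ^ 2 / 2) * (t : ℂ) ^ 2) := by ring
  rw [esplit, halg]
  calc ‖(Complex.log (1 + w) - (w - w ^ 2 / 2))
          + (E / (s : ℂ) - (w - (α : ℂ) * ((t : ℂ) * I)) * (w + (α : ℂ) * ((t : ℂ) * I)) / 2)‖
      ≤ ‖Complex.log (1 + w) - (w - w ^ 2 / 2)‖
          + (‖E / (s : ℂ)‖ + ‖(w - (α : ℂ) * ((t : ℂ) * I)) * (w + (α : ℂ) * ((t : ℂ) * I)) / 2‖) := by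
        have i1 := norm_add_le (Complex.log (1 + w) - (w - w ^ 2 / 2))
          (E / (s : ℂ) - (w - (α : ℂ) * ((t : ℂ) * I)) * (w + (α : ℂ) * ((t : ℂ) * I)) / 2)
        have i2 := norm_sub_le (E / (s : ℂ)) ((w - (α : ℂ) * ((t : ℂ) * I)) * (w + (α : ℂ) * ((t : ℂ) * I)) / 2)
        linarith
    _ ≤ Cw ^ 3 * |t| ^ 3 + (K₁ / s * |t| ^ 3 + (|β| + K₁ / s) * |t| ^ 2 * ((Cw + |α|) * |t|) / 2) := by
        have hprod : ‖(w - (α : ℂ) * ((t : ℂ) * I)) * (w + (α : ℂ) * ((t : ℂ) * I)) / 2‖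
            ≤ (|β| + K₁ / s) * |t| ^ 2 * ((Cw + |α|) * |t|) / 2 := by
          rw [norm_div, norm_mul, Complex.norm_two]
          exact div_le_div_of_nonneg_right (mul_le_mul hw1 hplus (norm_nonneg _) (by positivity)) (by norm_num)
        linarith [hrem, hEs, hprod]
    _ ≤ (Cw ^ 3 + K₁ / s + (|β| + K₁ / s) * (Cw + |α|)) * |t| ^ 3 := by
        have e3 : (|β| + K₁ / s) * |t| ^ 2 * ((Cw + |α|) * |t|) / 2 = (|β| + K₁ / s) * (Cw + |α|) * |t| ^ 3 / 2 := by ring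
        have hnn : 0 ≤ (|β| + K₁ / s) * (Cw + |α|) * |t| ^ 3 := by positivity
        rw [e3]
        linarith only [hnn]

end WidthOneYZ

end Literature.Probability.RandomPlanarGeometry.SAW.HexBW

end
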